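import Literature.Geometry.Lorentzian.Basic
import Literature.Geometry.Lorentzian.CauchyDevelopment
import Literature.Geometry.Lorentzian.TrappedSurface
import HarnessLib

/-!
# The black-hole census of a spacetime: at most `n` black holes on every Cauchy slice

Let `(M, g, τ)` be a `4`-dimensional spacetime. A *Cauchy slice* of `M` with its induced data is
rendered, in the vocabulary of `CauchyDevelopment.lean`, as a Cauchy development
`𝒟' : CauchyDevelopment D'` of *some* initial data set `D' = (h', k')` on *some* connected
`3`-manifold `X'` whose underlying spacetime is `M` (`𝒟'.toSpacetime = M`): then `ι'(X')` is a
Cauchy hypersurface of `M` and `(h', k')` are its first and second fundamental forms. On such a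
slice the black holes are counted by apparent horizons: Hawking–Ellis (1973, §9.2) call the outer
boundary of a connected component of the trapped region `𝒯(τ) ⊆ 𝒮(τ)` an *apparent horizon* and
count black holes on `𝒮(τ)` by connected components; Andersson–Metzger (CMP 290 (2009), Thm. 1.3
and Thm. 7.3) prove that the boundary of the (weakly outer) trapped region of a data set is a
smooth embedded stable MOTS, the unique *outermost MOTS*, with finitely many components
(Cor. 6.6). The tree's rendering of an outermost MOTS bounding an exterior region is the hypothesis
structure `OutermostMOTS (𝓡 3) h' k'` of `TrappedSurface.lean` (Andersson–Mars–Simon 2008, Def. 1–2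
and §5).

This file names the **census predicates** requested by route `CriticalAncestry` of the Final State
Conjecture (items `FiniteCensus`, `ExteriorSettlesUnderCensus`), verbatim:

* `Spacetime.BlackHoleCensusLE M n`: on every Cauchy slice `(X', D', 𝒟')` of `M`, among any
  `n + 1` instances `S₀, …, Sₙ : OutermostMOTS (𝓡 3) D'.h D'.k` with *connected* surfaces, two of
  the enclosed regions `(Sⱼ.exterior)ᶜ` intersect — "no Cauchy slice of `M` carries `n + 1`
  connected outermost MOTSs with pairwise disjoint enclosed regions", i.e. *at most `n` black holes
  coexist at any time*;
* `CauchyDevelopment.BlackHoleCensusLE 𝒟 n := 𝒟.toSpacetime.BlackHoleCensusLE n`, the form the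
  route consumed in its first revision (for `𝒟 : VacuumCauchyDevelopment D` one writes
  `𝒟.BlackHoleCensusLE n`, resolved through `toCauchyDevelopment`), with the unfolding lemma
  `CauchyDevelopment.blackHoleCensusLE_iff` displaying that clause literally;
* `Spacetime.BlackHoleBodyCensusLE M n` — the **repaired** clause (route `CriticalAncestry`, rev. 2,
  items `FiniteCensus` = stmt-FinalStateConjecture-13847 and `ExteriorSettlesUnderCensus` =
  stmt-FinalStateConjecture-13848), verbatim: the same census restricted to families whose
  *enclosed regions are compact bodies* — every `(Sⱼ.exterior)ᶜ` is compact with nonempty interior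
  (clause C′; see "Design choices" for why the unrestricted census is the wrong predicate);
* `CauchyDevelopment.BlackHoleBodyCensusLE 𝒟 n := 𝒟.toSpacetime.BlackHoleBodyCensusLE n`, the
  form the route consumes, with `CauchyDevelopment.blackHoleBodyCensusLE_iff` displaying the
  repaired clause literally (so that `FiniteCensus` reads `∀ …, ∃ n, 𝒟.BlackHoleBodyCensusLE n` by
  `Iff.rfl`).

API (all proved): monotonicity in `n` (`Spacetime.BlackHoleCensusLE.mono`,
`Spacetime.monotone_blackHoleCensusLE`); the counting form "every finite family of connected
outermost MOTSs with pairwise disjoint enclosed regions on a Cauchy slice has at most `n` members"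
(`Spacetime.blackHoleCensusLE_iff_forall_card_le`); the case `n = 0` — no Cauchy slice carries a
connected (hence nonempty) outermost MOTS instance (`Spacetime.blackHoleCensusLE_zero_iff`);
slicing independence — the census of a development depends only on its spacetime
(`CauchyDevelopment.blackHoleCensusLE_iff_of_toSpacetime_eq`); and contravariance under slice
transport (`Spacetime.BlackHoleCensusLE.of_forall_exists_cauchyDevelopment`: if every Cauchy slice
of `M₁`, with its data, is also a Cauchy slice of `M₂`, then the census of `M₂` bounds that of
`M₁`). The same API is proved for the body census (`Spacetime.BlackHoleBodyCensusLE.mono`,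
`Spacetime.monotone_blackHoleBodyCensusLE`, `Spacetime.blackHoleBodyCensusLE_iff_forall_card_le`,
`Spacetime.blackHoleBodyCensusLE_zero_iff` — no Cauchy slice carries a connected outermost MOTS
instance whose enclosed region is a compact body —,
`CauchyDevelopment.blackHoleBodyCensusLE_iff_of_toSpacetime_eq`,
`Spacetime.BlackHoleBodyCensusLE.of_forall_exists_cauchyDevelopment`), together with the comparison
`Spacetime.BlackHoleCensusLE.blackHoleBodyCensusLE`: the unrestricted census implies the body census
(drop the body hypothesis).

## Design choices

* *Families of connected instances, not components of one instance* (route `CriticalAncestry`,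
  definition request). The outermost test `OutermostMOTS.no_weaklyOuterTrapped_in_exterior` of a
  multi-component instance only sees test surfaces enclosing *all* components at once, so
  `{apparent horizon of hole 1, an inner MOTS of hole 2}` is a legitimate instance; counting
  components of one instance would therefore over-count, which is why the census quantifies over
  families of connected instances and asks two *enclosed regions* (complements `(Sⱼ.exterior)ᶜ`
  of the open exteriors, containing `range Sⱼ.f` by `OutermostMOTS.range_inter_exterior`) to meet.
* *A connected instance need not be an apparent horizon: the compact-body clause C′.* (This
  corrects the sentence "a single connected instance is honestly outermost" that stood here in
  the first version of this file; refuter review of `FiniteCensus`, item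
  stmt-FinalStateConjecture-10069, and the attack on stmt-FinalStateConjecture-10503, 2026-08-15.)
  The structure `OutermostMOTS` ties neither the exterior region nor the normal `ν` to an
  asymptotic end of the slice, and no field asks the enclosed region `(exterior)ᶜ` to be bounded
  or to have interior points. In particular the fields `frontier_exterior` / `pointsInto` admit the
  two-sided *slit* exterior `exterior = X' ∖ range f` (for a closed hypersurface `range f` with
  empty interior its frontier is `range f`, and a transversal `ν` of either sign points into it),
  whose "enclosed region" is `range f` itself; with `ν` pointing *away* from the end the field
  `θ⁺ = tr_S k + H = 0` w.r.t. `ν` is the *ingoing* expansion condition seen from the end, and the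
  outermost field only forbids weakly outer trapped surfaces enclosing `S` on the `ν`-side within a
  compact collar. The refuters' witness: the leaves of a compact piece of the (time-reversed)
  smooth spacelike MOTS-foliated apparent horizon of anisotropic gravitational collapse (An–Han
  2020, arXiv:2010.12524, Thm. 1.4–1.6) lying in one Cauchy slice satisfy, with slit exteriors and
  `ν` away from the end, every field of the structure, and are then, for every `n`, `n + 1`
  connected instances with pairwise disjoint "enclosed regions" (the leaves themselves) — so
  `BlackHoleCensusLE M n` fails for every `n` on such a spacetime, and `FiniteCensus` phrased with
  it was refuted as mis-stated (stmt-FinalStateConjecture-10069). The repaired clause C′ asks, per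
  instance, that the enclosed region `(Sⱼ.exterior)ᶜ` be **compact with nonempty interior**: slit
  instances (empty interior), instances whose exterior is the bounded side of a one-ended slice
  (non-compact complement) and non-separating surfaces (slit forced) are excluded, so that on a
  one-ended Cauchy slice `Sⱼ` separates with its exterior on the end side, `ν` is end-ward, and
  `θ⁺ = 0` is the genuine future-outgoing expansion — the reading the route intends.
  `BlackHoleBodyCensusLE` is `BlackHoleCensusLE` with C′ added as a hypothesis on the family,
  inlined verbatim as the route states it (so the unrestricted predicate implies the repaired one,
  `BlackHoleCensusLE.blackHoleBodyCensusLE`); the unrestricted predicate is kept, unchanged, for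
  the items that still quote it. The refuters' preferred long-term repair — C′ as fields of
  `OutermostMOTS` itself — is recorded, not done here (it touches the Penrose-inequality users of
  the structure in `MassInequalities.lean`).
* *Slices as Cauchy developments.* "Cauchy slice of `M` with induced data `(h', k')`" is
  `∃ (X', D', 𝒟' : CauchyDevelopment D')` with `𝒟'.toSpacetime = M`; this is the only rendering
  available without an "induced data of an embedded hypersurface" construction, and it is the one
  the route's items use. The slice manifold `X'` ranges over the universe of `M`'s carrier
  (`Type u`; the route has `u = 0`).
* *Two levels.* Both clauses depend on a development `𝒟` only through `𝒟.toSpacetime`, so the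
  primary definitions are on `Spacetime 4` (usable for spacetimes not presented as developments)
  and the development forms are `abbrev`s; slicing independence is then by `rfl`.
* Dimension is fixed (`3 + 1`): `OutermostMOTS` is a `2`-surface in a `3`-manifold.

## What is not here

* *Invariance under time-orientation-preserving isometries* (hence under
  `CauchyDevelopment.IsIsometricTo`): by `BlackHoleCensusLE.of_forall_exists_cauchyDevelopment` it
  reduces to transporting a `CauchyDevelopment D'` inside `M₁` along an isometry `ψ : M₁ ≃ M₂`
  (`ι ↦ ψ ∘ ι`, `ν ↦ dψ ν`; O'Neill 1983, Ch. 3, Prop. 3.59–Cor. 3.61). The fields `induced_h`,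
  `isFutureUnitNormal`, `isCauchyHypersurface` transport by the chain rule, but `induced_k` needs
  naturality of `covariantDerivAlong`/`secondFundamentalForm` under isometries for normal fields of
  unrestricted regularity (the structure imposes none on `ν`), which the tree does not have
  (`ConnectionNaturality.lean` treats vector fields on `M`, not fields along maps). Not vendored as
  a named fact (D-0026); recorded here for the tenure planner. TODO(isometry invariance).
* The dichotomy "two connected outermost MOTSs on one slice have nested-intersecting or disjoint
  enclosed regions" and the per-slice finiteness (Andersson–Metzger 2009, Cor. 6.6) are theorems
  about MOTSs, not part of the census vocabulary; they are not stated here.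

## References

* S. W. Hawking, G. F. R. Ellis, *The large scale structure of space-time*, CUP 1973, §9.2
  (black holes on a slice `𝒮(τ)` as connected components of `ℬ(τ)`; trapped region `𝒯(τ)`,
  apparent horizons, Prop. 9.2.8; their number along `τ`).
* L. Andersson, J. Metzger, *The area of horizons and the trapped region*, Comm. Math. Phys. 290
  (2009) 941–972, Thm. 1.3, Def. 2.3, Cor. 6.6, Def. 7.1–7.2, Thm. 7.3 (arXiv:0708.4252).
* L. Andersson, M. Mars, W. Simon, *Stability of marginally outer trapped surfaces and existence
  of marginally outer trapped tubes*, Adv. Theor. Math. Phys. 12 (2008) 853–888, Def. 1–2, §5.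
* B. O'Neill, *Semi-Riemannian geometry*, Academic Press 1983, Ch. 3, Prop. 3.59–Cor. 3.61.
* X. An, Q. Han, *Anisotropic dynamical horizons arising in gravitational collapse*,
  arXiv:2010.12524 (2020) (`AnHan2020`): Thm. 1.4 (after An 2017: a unique MOTS `M_u̲` on each
  incoming cone, forming a smooth, spacelike apparent horizon), Thm. 1.5 (the same from anisotropic
  scale-critical data: the MOTSs `{M_u̲}` form a smooth spacelike hypersurface, the dynamical
  horizon), Thm. 1.6 (multi-valley anisotropic horizons) — the MOTS-foliated spacelike apparent
  horizons used by the refuters as witnesses against the unrestricted census.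
-/

noncomputable section

open Manifold Set
open scoped ContDiff

universe u

namespace Literature.Geometry.Lorentzian

namespace Spacetime

/-- The **black-hole census** of the `4`-dimensional spacetime `M` is **at most `n`**: for every
Cauchy slice of `M` — any Cauchy development `𝒟' : CauchyDevelopment D'` of any initial data set
`D'` on any connected `3`-manifold `X'` with `𝒟'.toSpacetime = M` — and every family
`S₀, …, Sₙ : OutermostMOTS (𝓡 3) D'.h D'.k` of outermost MOTSs of the slice data with *connected*
surfaces, two of the enclosed regions meet: there are `j ≠ j'` with
`(Sⱼ.exterior)ᶜ ∩ (Sⱼ'.exterior)ᶜ ≠ ∅`. Informally: no Cauchy slice of `M` carries `n + 1`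
connected outermost MOTSs (apparent horizons) with pairwise disjoint enclosed regions, i.e. at most
`n` black holes coexist at any time (Hawking–Ellis 1973, §9.2: black holes on a slice counted by
connected components, apparent horizon = outer boundary of a component of the trapped region;
Andersson–Metzger 2009, Thm. 1.3 and 7.3: the boundary of the trapped region is the unique outermost
MOTS, with finitely many components, Cor. 6.6). The census clause of the first revision of route
`CriticalAncestry` of the Final State Conjecture (item stmt-FinalStateConjecture-10069, since
repaired: see `BlackHoleBodyCensusLE` and the module docstring, "Design choices") and of route
`HarmonicFluxCensus` (item `ExteriorSettlesUnderCensus`), verbatim.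
[cite: AnderssonMetzgerTrapped2009, Thm. 1.3, Cor. 6.6, Thm. 7.3] -/
def BlackHoleCensusLE (M : Spacetime.{u} 4) (n : ℕ) : Prop :=
  ∀ (X' : Type u) [TopologicalSpace X'] [ChartedSpace E3 X'] [IsManifold (𝓡 3) ∞ X']
    [ConnectedSpace X'] (D' : InitialDataSet (𝓡 3) X') (𝒟' : CauchyDevelopment D'),
    𝒟'.toSpacetime = M →
      ∀ S : Fin (n + 1) → OutermostMOTS (𝓡 3) D'.h D'.k, (∀ j, ConnectedSpace (S j).surf) →
        ∃ j j', j ≠ j' ∧ ((((S j).exterior : Set X'))ᶜ ∩ (((S j').exterior : Set X'))ᶜ).Nonempty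

variable {M M₁ M₂ : Spacetime.{u} 4} {m n : ℕ}

/-- **Monotonicity of the census in `n`**: at most `m` black holes and `m ≤ n` give at most `n`
(restrict a family of `n + 1` connected outermost MOTSs to its first `m + 1` members).
[folklore] -/
theorem BlackHoleCensusLE.mono (hmn : m ≤ n) (h : M.BlackHoleCensusLE m) :
    M.BlackHoleCensusLE n := by
  intro X' _ _ _ _ D' 𝒟' hM S hS
  have hle : m + 1 ≤ n + 1 := by omega
  obtain ⟨j, j', hne, hx⟩ := h X' D' 𝒟' hM (fun i ↦ S (Fin.castLE hle i))
    fun i ↦ hS (Fin.castLE hle i)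
  exact ⟨Fin.castLE hle j, Fin.castLE hle j', fun heq ↦ hne (Fin.castLE_injective hle heq), hx⟩

variable (M) in
/-- The census predicate `n ↦ BlackHoleCensusLE M n` is monotone (`Prop` ordered by
implication). [folklore] -/
theorem monotone_blackHoleCensusLE : Monotone M.BlackHoleCensusLE :=
  fun _ _ hmn h ↦ h.mono hmn

variable (M n) in
/-- **Counting form of the census.** `BlackHoleCensusLE M n` holds iff on every Cauchy slice of
`M` every finite family `S₀, …, S_{k-1}` of outermost MOTSs with connected surfaces and *pairwise
disjoint enclosed regions* `(Sⱼ.exterior)ᶜ` has at most `n` members (`k ≤ n`): "at most `n`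
black holes on every Cauchy slice" (Hawking–Ellis 1973, §9.2). [folklore] -/
theorem blackHoleCensusLE_iff_forall_card_le :
    M.BlackHoleCensusLE n ↔
      ∀ (X' : Type u) [TopologicalSpace X'] [ChartedSpace E3 X'] [IsManifold (𝓡 3) ∞ X']
        [ConnectedSpace X'] (D' : InitialDataSet (𝓡 3) X') (𝒟' : CauchyDevelopment D'),
        𝒟'.toSpacetime = M →
          ∀ (k : ℕ) (S : Fin k → OutermostMOTS (𝓡 3) D'.h D'.k), (∀ j, ConnectedSpace (S j).surf) →
            Pairwise (fun j j' ↦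
              Disjoint (((S j).exterior : Set X'))ᶜ (((S j').exterior : Set X'))ᶜ) →
            k ≤ n := by
  constructor
  · intro h X' _ _ _ _ D' 𝒟' hM k S hS hdisj
    by_contra hk
    have hk' : n + 1 ≤ k := by omega
    obtain ⟨j, j', hne, hx⟩ := h X' D' 𝒟' hM (fun i ↦ S (Fin.castLE hk' i))
      fun i ↦ hS (Fin.castLE hk' i)
    exact hx.ne_empty (Set.disjoint_iff_inter_eq_empty.mp
      (hdisj fun heq ↦ hne (Fin.castLE_injective hk' heq)))
  · intro h X' _ _ _ _ D' 𝒟' hM S hS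
    by_contra hno
    have hk : n + 1 ≤ n :=
      h X' D' 𝒟' hM (n + 1) S hS fun j j' hne ↦
        Set.disjoint_iff_inter_eq_empty.mpr
          (Set.not_nonempty_iff_eq_empty.mp fun hx ↦ hno ⟨j, j', hne, hx⟩)
    omega

variable (M) in
/-- **Census zero.** `BlackHoleCensusLE M 0` holds iff no Cauchy slice of `M` carries an
outermost MOTS instance with connected — in particular nonempty — surface: "no black hole at any
time". [folklore] -/
theorem blackHoleCensusLE_zero_iff :
    M.BlackHoleCensusLE 0 ↔
      ∀ (X' : Type u) [TopologicalSpace X'] [ChartedSpace E3 X'] [IsManifold (𝓡 3) ∞ X']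
        [ConnectedSpace X'] (D' : InitialDataSet (𝓡 3) X') (𝒟' : CauchyDevelopment D'),
        𝒟'.toSpacetime = M → ∀ S : OutermostMOTS (𝓡 3) D'.h D'.k, ¬ ConnectedSpace S.surf := by
  constructor
  · intro h X' _ _ _ _ D' 𝒟' hM S hS
    obtain ⟨j, j', hne, -⟩ := h X' D' 𝒟' hM (fun _ ↦ S) fun _ ↦ hS
    exact hne (Fin.ext (by have := j.isLt; have := j'.isLt; omega))
  · intro h X' _ _ _ _ D' 𝒟' hM S hS
    exact (h X' D' 𝒟' hM (S 0) (hS 0)).elim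

/-- Under census zero every outermost MOTS instance with preconnected surface on a Cauchy slice of
`M` has *empty* surface (a preconnected nonempty space is connected). [folklore] -/
theorem BlackHoleCensusLE.isEmpty_surf (h : M.BlackHoleCensusLE 0) {X' : Type u}
    [TopologicalSpace X'] [ChartedSpace E3 X'] [IsManifold (𝓡 3) ∞ X'] [ConnectedSpace X']
    {D' : InitialDataSet (𝓡 3) X'} (𝒟' : CauchyDevelopment D') (hM : 𝒟'.toSpacetime = M)
    (S : OutermostMOTS (𝓡 3) D'.h D'.k) [PreconnectedSpace S.surf] : IsEmpty S.surf := by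
  by_contra hne
  rw [not_isEmpty_iff] at hne
  exact (blackHoleCensusLE_zero_iff M).mp h X' D' 𝒟' hM S ⟨hne⟩

/-- **Contravariance under slice transport.** If every Cauchy slice of `M₁` together with its
induced data — every `𝒟' : CauchyDevelopment D'` with `𝒟'.toSpacetime = M₁` — is also (the data
of) a Cauchy slice of `M₂` (some `𝒟'' : CauchyDevelopment D'` of the *same* data has
`𝒟''.toSpacetime = M₂`), then the census of `M₂` bounds the census of `M₁`. A
time-orientation-preserving isometry `ψ : M₁ ≃ M₂` provides such a transport (`ι ↦ ψ ∘ ι`;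
O'Neill 1983, Ch. 3, Prop. 3.59–Cor. 3.61), which is how invariance of the census under
`CauchyDevelopment.IsIsometricTo` is to be obtained (see the module docstring, "What is not
here"). [folklore] -/
theorem BlackHoleCensusLE.of_forall_exists_cauchyDevelopment
    (hT : ∀ (X' : Type u) [TopologicalSpace X'] [ChartedSpace E3 X'] [IsManifold (𝓡 3) ∞ X']
      [ConnectedSpace X'] (D' : InitialDataSet (𝓡 3) X') (𝒟' : CauchyDevelopment D'),
      𝒟'.toSpacetime = M₁ → ∃ 𝒟'' : CauchyDevelopment D', 𝒟''.toSpacetime = M₂)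
    (h : M₂.BlackHoleCensusLE n) : M₁.BlackHoleCensusLE n := by
  intro X' _ _ _ _ D' 𝒟' hM S hS
  obtain ⟨𝒟'', hM''⟩ := hT X' D' 𝒟' hM
  exact h X' D' 𝒟'' hM'' S hS

/-!
### The repaired census: enclosed regions that are compact bodies (clause C′)
-/

/-- The **black-hole body census** of the `4`-dimensional spacetime `M` is **at most `n`** — the
*repaired* census clause of route `CriticalAncestry` (rev. 2, items `FiniteCensus`,
`ExteriorSettlesUnderCensus`), verbatim: for every Cauchy slice of `M` — any Cauchy development
`𝒟' : CauchyDevelopment D'` of any initial data set `D'` on any connected `3`-manifold `X'` with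
`𝒟'.toSpacetime = M` — and every family `S₀, …, Sₙ : OutermostMOTS (𝓡 3) D'.h D'.k` of outermost
MOTSs of the slice data with *connected* surfaces **whose enclosed regions are compact bodies** —
every `(Sⱼ.exterior)ᶜ` is compact with nonempty interior (clause C′: on a one-ended slice, `Sⱼ`
separates and its exterior is the end side, so `θ⁺ = 0` is the outgoing expansion; slit exteriors
`X' ∖ range f`, bounded exteriors and non-separating surfaces are excluded, see the module
docstring) — two of the enclosed regions meet: there are `j ≠ j'` with
`(Sⱼ.exterior)ᶜ ∩ (Sⱼ'.exterior)ᶜ ≠ ∅`. Informally: no Cauchy slice of `M` carries `n + 1`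
connected apparent horizons bounding pairwise disjoint compact bodies, i.e. at most `n` black holes
coexist at any time (Hawking–Ellis 1973, §9.2: black holes on a slice counted by connected
components, apparent horizon = outer boundary of a component of the trapped region;
Andersson–Metzger 2009, Thm. 1.3 and 7.3: the boundary of the trapped region is the unique outermost
MOTS, with finitely many components, Cor. 6.6).
[cite: AnderssonMetzgerTrapped2009, Thm. 1.3, Cor. 6.6, Thm. 7.3] -/
def BlackHoleBodyCensusLE (M : Spacetime.{u} 4) (n : ℕ) : Prop :=
  ∀ (X' : Type u) [TopologicalSpace X'] [ChartedSpace E3 X'] [IsManifold (𝓡 3) ∞ X']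
    [ConnectedSpace X'] (D' : InitialDataSet (𝓡 3) X') (𝒟' : CauchyDevelopment D'),
    𝒟'.toSpacetime = M →
      ∀ S : Fin (n + 1) → OutermostMOTS (𝓡 3) D'.h D'.k, (∀ j, ConnectedSpace (S j).surf) →
        (∀ j, IsCompact (((S j).exterior : Set X'))ᶜ ∧
          (interior (((S j).exterior : Set X'))ᶜ).Nonempty) →
        ∃ j j', j ≠ j' ∧ ((((S j).exterior : Set X'))ᶜ ∩ (((S j').exterior : Set X'))ᶜ).Nonempty

/-- **The unrestricted census implies the body census** (drop the compact-body hypothesis C′):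
`BlackHoleCensusLE M n → BlackHoleBodyCensusLE M n`. [folklore] -/
theorem BlackHoleCensusLE.blackHoleBodyCensusLE (h : M.BlackHoleCensusLE n) :
    M.BlackHoleBodyCensusLE n :=
  fun X' _ _ _ _ D' 𝒟' hM S hS _ ↦ h X' D' 𝒟' hM S hS

/-- **Monotonicity of the body census in `n`**: at most `m` black holes and `m ≤ n` give at most
`n` (restrict a family of `n + 1` instances to its first `m + 1` members; connectedness and the
body clause restrict with it). [folklore] -/
theorem BlackHoleBodyCensusLE.mono (hmn : m ≤ n) (h : M.BlackHoleBodyCensusLE m) :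
    M.BlackHoleBodyCensusLE n := by
  intro X' _ _ _ _ D' 𝒟' hM S hS hB
  have hle : m + 1 ≤ n + 1 := by omega
  obtain ⟨j, j', hne, hx⟩ := h X' D' 𝒟' hM (fun i ↦ S (Fin.castLE hle i))
    (fun i ↦ hS (Fin.castLE hle i)) fun i ↦ hB (Fin.castLE hle i)
  exact ⟨Fin.castLE hle j, Fin.castLE hle j', fun heq ↦ hne (Fin.castLE_injective hle heq), hx⟩

variable (M) in
/-- The body-census predicate `n ↦ BlackHoleBodyCensusLE M n` is monotone (`Prop` ordered by
implication). [folklore] -/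
theorem monotone_blackHoleBodyCensusLE : Monotone M.BlackHoleBodyCensusLE :=
  fun _ _ hmn h ↦ h.mono hmn

variable (M n) in
/-- **Counting form of the body census.** `BlackHoleBodyCensusLE M n` holds iff on every Cauchy
slice of `M` every finite family `S₀, …, S_{k-1}` of outermost MOTSs with connected surfaces,
enclosed regions `(Sⱼ.exterior)ᶜ` that are compact bodies (compact, nonempty interior) and
*pairwise disjoint* enclosed regions has at most `n` members (`k ≤ n`): "at most `n` black holes
on every Cauchy slice" (Hawking–Ellis 1973, §9.2). [folklore] -/
theorem blackHoleBodyCensusLE_iff_forall_card_le :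
    M.BlackHoleBodyCensusLE n ↔
      ∀ (X' : Type u) [TopologicalSpace X'] [ChartedSpace E3 X'] [IsManifold (𝓡 3) ∞ X']
        [ConnectedSpace X'] (D' : InitialDataSet (𝓡 3) X') (𝒟' : CauchyDevelopment D'),
        𝒟'.toSpacetime = M →
          ∀ (k : ℕ) (S : Fin k → OutermostMOTS (𝓡 3) D'.h D'.k), (∀ j, ConnectedSpace (S j).surf) →
            (∀ j, IsCompact (((S j).exterior : Set X'))ᶜ ∧
              (interior (((S j).exterior : Set X'))ᶜ).Nonempty) →
            Pairwise (fun j j' ↦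
              Disjoint (((S j).exterior : Set X'))ᶜ (((S j').exterior : Set X'))ᶜ) →
            k ≤ n := by
  constructor
  · intro h X' _ _ _ _ D' 𝒟' hM k S hS hB hdisj
    by_contra hk
    have hk' : n + 1 ≤ k := by omega
    obtain ⟨j, j', hne, hx⟩ := h X' D' 𝒟' hM (fun i ↦ S (Fin.castLE hk' i))
      (fun i ↦ hS (Fin.castLE hk' i)) fun i ↦ hB (Fin.castLE hk' i)
    exact hx.ne_empty (Set.disjoint_iff_inter_eq_empty.mp
      (hdisj fun heq ↦ hne (Fin.castLE_injective hk' heq)))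
  · intro h X' _ _ _ _ D' 𝒟' hM S hS hB
    by_contra hno
    have hk : n + 1 ≤ n :=
      h X' D' 𝒟' hM (n + 1) S hS hB fun j j' hne ↦
        Set.disjoint_iff_inter_eq_empty.mpr
          (Set.not_nonempty_iff_eq_empty.mp fun hx ↦ hno ⟨j, j', hne, hx⟩)
    omega

variable (M) in
/-- **Body census zero.** `BlackHoleBodyCensusLE M 0` holds iff no Cauchy slice of `M` carries an
outermost MOTS instance with connected surface whose enclosed region is a compact body: for every
such instance with compact enclosed region `(S.exterior)ᶜ`, that region has empty interior — "no
black hole at any time". [folklore] -/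
theorem blackHoleBodyCensusLE_zero_iff :
    M.BlackHoleBodyCensusLE 0 ↔
      ∀ (X' : Type u) [TopologicalSpace X'] [ChartedSpace E3 X'] [IsManifold (𝓡 3) ∞ X']
        [ConnectedSpace X'] (D' : InitialDataSet (𝓡 3) X') (𝒟' : CauchyDevelopment D'),
        𝒟'.toSpacetime = M → ∀ S : OutermostMOTS (𝓡 3) D'.h D'.k, ConnectedSpace S.surf →
          IsCompact ((S.exterior : Set X'))ᶜ → interior ((S.exterior : Set X'))ᶜ = ∅ := by
  constructor
  · intro h X' _ _ _ _ D' 𝒟' hM S hS hK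
    refine Set.not_nonempty_iff_eq_empty.mp fun hint ↦ ?_
    obtain ⟨j, j', hne, -⟩ := h X' D' 𝒟' hM (fun _ ↦ S) (fun _ ↦ hS) fun _ ↦ ⟨hK, hint⟩
    exact hne (Fin.ext (by have := j.isLt; have := j'.isLt; omega))
  · intro h X' _ _ _ _ D' 𝒟' hM S hS hB
    exact ((Set.not_nonempty_iff_eq_empty.mpr (h X' D' 𝒟' hM (S 0) (hS 0) (hB 0).1)) (hB 0).2).elim

/-- **Contravariance of the body census under slice transport.** If every Cauchy slice of `M₁`
together with its induced data — every `𝒟' : CauchyDevelopment D'` with `𝒟'.toSpacetime = M₁` —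
is also (the data of) a Cauchy slice of `M₂` (some `𝒟'' : CauchyDevelopment D'` of the *same* data
has `𝒟''.toSpacetime = M₂`), then the body census of `M₂` bounds the body census of `M₁` (the
clause C′ is a condition on the data side `X'` only). A time-orientation-preserving isometry
`ψ : M₁ ≃ M₂` provides such a transport (O'Neill 1983, Ch. 3, Prop. 3.59–Cor. 3.61; see the module
docstring, "What is not here"). [folklore] -/
theorem BlackHoleBodyCensusLE.of_forall_exists_cauchyDevelopment
    (hT : ∀ (X' : Type u) [TopologicalSpace X'] [ChartedSpace E3 X'] [IsManifold (𝓡 3) ∞ X']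
      [ConnectedSpace X'] (D' : InitialDataSet (𝓡 3) X') (𝒟' : CauchyDevelopment D'),
      𝒟'.toSpacetime = M₁ → ∃ 𝒟'' : CauchyDevelopment D', 𝒟''.toSpacetime = M₂)
    (h : M₂.BlackHoleBodyCensusLE n) : M₁.BlackHoleBodyCensusLE n := by
  intro X' _ _ _ _ D' 𝒟' hM S hS hB
  obtain ⟨𝒟'', hM''⟩ := hT X' D' 𝒟' hM
  exact h X' D' 𝒟'' hM'' S hS hB

end Spacetime

namespace CauchyDevelopment

variable {X : Type u} [TopologicalSpace X] [ChartedSpace E3 X] [IsManifold (𝓡 3) ∞ X]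
  [ConnectedSpace X] {D : InitialDataSet (𝓡 3) X}

/-- The **black-hole census** of the Cauchy development `𝒟` of `3`-dimensional data is **at most
`n`**: the census of its spacetime, `𝒟.toSpacetime.BlackHoleCensusLE n` — no Cauchy slice of the
development carries `n + 1` connected outermost MOTSs with pairwise disjoint enclosed regions. For
`𝒟 : VacuumCauchyDevelopment D` write `𝒟.BlackHoleCensusLE n` (resolved through
`toCauchyDevelopment`). This is the predicate `BlackHoleCensusLE 𝒟 n` requested by the first
revision of route `CriticalAncestry` of the Final State Conjecture (since repaired:
`BlackHoleBodyCensusLE`); `blackHoleCensusLE_iff` displays its clause verbatim (Hawking–Ellis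
1973, §9.2; Andersson–Metzger 2009, Thm. 1.3).
[cite: AnderssonMetzgerTrapped2009, Thm. 1.3, Cor. 6.6, Thm. 7.3] -/
abbrev BlackHoleCensusLE (𝒟 : CauchyDevelopment D) (n : ℕ) : Prop :=
  𝒟.toSpacetime.BlackHoleCensusLE n

/-- Unfolding lemma: `𝒟.BlackHoleCensusLE n` is, verbatim, the census clause of the
first-revision items `FiniteCensus` (stmt-FinalStateConjecture-10069) /
`ExteriorSettlesUnderCensus` (stmt-FinalStateConjecture-10070) of route `CriticalAncestry` (the
repaired items unfold by `blackHoleBodyCensusLE_iff`). [folklore] -/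
theorem blackHoleCensusLE_iff (𝒟 : CauchyDevelopment D) (n : ℕ) :
    𝒟.BlackHoleCensusLE n ↔
      ∀ (X' : Type u) [TopologicalSpace X'] [ChartedSpace E3 X'] [IsManifold (𝓡 3) ∞ X']
        [ConnectedSpace X'] (D' : InitialDataSet (𝓡 3) X') (𝒟' : CauchyDevelopment D'),
        𝒟'.toSpacetime = 𝒟.toSpacetime →
          ∀ S : Fin (n + 1) → OutermostMOTS (𝓡 3) D'.h D'.k, (∀ j, ConnectedSpace (S j).surf) →
            ∃ j j', j ≠ j' ∧
              ((((S j).exterior : Set X'))ᶜ ∩ (((S j').exterior : Set X'))ᶜ).Nonempty :=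
  Iff.rfl

/-- **Slicing independence.** Cauchy developments with the same underlying spacetime — e.g. the
developments of the data induced on two different Cauchy slices `X₁`, `X₂` of one spacetime — have
the same census. [folklore] -/
theorem blackHoleCensusLE_iff_of_toSpacetime_eq {X₂ : Type u} [TopologicalSpace X₂]
    [ChartedSpace E3 X₂] [IsManifold (𝓡 3) ∞ X₂] [ConnectedSpace X₂] {D₂ : InitialDataSet (𝓡 3) X₂}
    {𝒟₁ : CauchyDevelopment D} {𝒟₂ : CauchyDevelopment D₂} (h : 𝒟₁.toSpacetime = 𝒟₂.toSpacetime)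
    (n : ℕ) : 𝒟₁.BlackHoleCensusLE n ↔ 𝒟₂.BlackHoleCensusLE n := by
  show 𝒟₁.toSpacetime.BlackHoleCensusLE n ↔ 𝒟₂.toSpacetime.BlackHoleCensusLE n
  rw [h]

/-- Monotonicity of the census of a development in `n`. [folklore] -/
theorem BlackHoleCensusLE.mono {𝒟 : CauchyDevelopment D} {m n : ℕ} (hmn : m ≤ n)
    (h : 𝒟.BlackHoleCensusLE m) : 𝒟.BlackHoleCensusLE n :=
  Spacetime.BlackHoleCensusLE.mono hmn h

/-- A development is itself one of its Cauchy slices: under `𝒟.BlackHoleCensusLE n`, among any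
`n + 1` connected outermost MOTSs of the data `D = (h, k)` of `𝒟` two enclosed regions meet.
[folklore] -/
theorem BlackHoleCensusLE.self {𝒟 : CauchyDevelopment D} {n : ℕ} (h : 𝒟.BlackHoleCensusLE n)
    (S : Fin (n + 1) → OutermostMOTS (𝓡 3) D.h D.k) (hS : ∀ j, ConnectedSpace (S j).surf) :
    ∃ j j', j ≠ j' ∧ ((((S j).exterior : Set X))ᶜ ∩ (((S j').exterior : Set X))ᶜ).Nonempty :=
  h X D 𝒟 rfl S hS

/-- The **black-hole body census** of the Cauchy development `𝒟` of `3`-dimensional data is **at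
most `n`**: the body census of its spacetime, `𝒟.toSpacetime.BlackHoleBodyCensusLE n` — no Cauchy
slice of the development carries `n + 1` connected outermost MOTSs whose enclosed regions are
pairwise disjoint compact bodies (clause C′). For `𝒟 : VacuumCauchyDevelopment D` write
`𝒟.BlackHoleBodyCensusLE n` (resolved through `toCauchyDevelopment`). This is the repaired census
predicate of route `CriticalAncestry` (rev. 2) of the Final State Conjecture: its item
`FiniteCensus` is literally `∀ …, ∃ n, 𝒟.BlackHoleBodyCensusLE n`, and
`blackHoleBodyCensusLE_iff` displays the clause verbatim (Hawking–Ellis 1973, §9.2;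
Andersson–Metzger 2009, Thm. 1.3).
[cite: AnderssonMetzgerTrapped2009, Thm. 1.3, Cor. 6.6, Thm. 7.3] -/
abbrev BlackHoleBodyCensusLE (𝒟 : CauchyDevelopment D) (n : ℕ) : Prop :=
  𝒟.toSpacetime.BlackHoleBodyCensusLE n

/-- Unfolding lemma: `𝒟.BlackHoleBodyCensusLE n` is, verbatim, the repaired census clause of the
items `FiniteCensus` (stmt-FinalStateConjecture-13847) / `ExteriorSettlesUnderCensus`
(stmt-FinalStateConjecture-13848) of route `CriticalAncestry`. [folklore] -/
theorem blackHoleBodyCensusLE_iff (𝒟 : CauchyDevelopment D) (n : ℕ) :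
    𝒟.BlackHoleBodyCensusLE n ↔
      ∀ (X' : Type u) [TopologicalSpace X'] [ChartedSpace E3 X'] [IsManifold (𝓡 3) ∞ X']
        [ConnectedSpace X'] (D' : InitialDataSet (𝓡 3) X') (𝒟' : CauchyDevelopment D'),
        𝒟'.toSpacetime = 𝒟.toSpacetime →
          ∀ S : Fin (n + 1) → OutermostMOTS (𝓡 3) D'.h D'.k, (∀ j, ConnectedSpace (S j).surf) →
            (∀ j, IsCompact (((S j).exterior : Set X'))ᶜ ∧
              (interior (((S j).exterior : Set X'))ᶜ).Nonempty) →
            ∃ j j', j ≠ j' ∧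
              ((((S j).exterior : Set X'))ᶜ ∩ (((S j').exterior : Set X'))ᶜ).Nonempty :=
  Iff.rfl

/-- **Slicing independence** of the body census: Cauchy developments with the same underlying
spacetime have the same body census. [folklore] -/
theorem blackHoleBodyCensusLE_iff_of_toSpacetime_eq {X₂ : Type u} [TopologicalSpace X₂]
    [ChartedSpace E3 X₂] [IsManifold (𝓡 3) ∞ X₂] [ConnectedSpace X₂] {D₂ : InitialDataSet (𝓡 3) X₂}
    {𝒟₁ : CauchyDevelopment D} {𝒟₂ : CauchyDevelopment D₂} (h : 𝒟₁.toSpacetime = 𝒟₂.toSpacetime)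
    (n : ℕ) : 𝒟₁.BlackHoleBodyCensusLE n ↔ 𝒟₂.BlackHoleBodyCensusLE n := by
  show 𝒟₁.toSpacetime.BlackHoleBodyCensusLE n ↔ 𝒟₂.toSpacetime.BlackHoleBodyCensusLE n
  rw [h]

/-- The unrestricted census of a development implies its body census. [folklore] -/
theorem BlackHoleCensusLE.blackHoleBodyCensusLE {𝒟 : CauchyDevelopment D} {n : ℕ}
    (h : 𝒟.BlackHoleCensusLE n) : 𝒟.BlackHoleBodyCensusLE n :=
  Spacetime.BlackHoleCensusLE.blackHoleBodyCensusLE h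

/-- Monotonicity of the body census of a development in `n`. [folklore] -/
theorem BlackHoleBodyCensusLE.mono {𝒟 : CauchyDevelopment D} {m n : ℕ} (hmn : m ≤ n)
    (h : 𝒟.BlackHoleBodyCensusLE m) : 𝒟.BlackHoleBodyCensusLE n :=
  Spacetime.BlackHoleBodyCensusLE.mono hmn h

/-- A development is itself one of its Cauchy slices: under `𝒟.BlackHoleBodyCensusLE n`, among
any `n + 1` connected outermost MOTSs of the data `D = (h, k)` of `𝒟` whose enclosed regions are
compact bodies, two enclosed regions meet. [folklore] -/
theorem BlackHoleBodyCensusLE.self {𝒟 : CauchyDevelopment D} {n : ℕ}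
    (h : 𝒟.BlackHoleBodyCensusLE n) (S : Fin (n + 1) → OutermostMOTS (𝓡 3) D.h D.k)
    (hS : ∀ j, ConnectedSpace (S j).surf)
    (hB : ∀ j, IsCompact (((S j).exterior : Set X))ᶜ ∧
      (interior (((S j).exterior : Set X))ᶜ).Nonempty) :
    ∃ j j', j ≠ j' ∧ ((((S j).exterior : Set X))ᶜ ∩ (((S j').exterior : Set X))ᶜ).Nonempty :=
  h X D 𝒟 rfl S hS hB

end CauchyDevelopment

end Literature.Geometry.Lorentzian

end
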